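import Summits.ResolutionOfSingularities.ResolutionOfSingularities.Theorems.WildTwistedToricLU2
import HarnessLib

/-!
# WildTwistedToricLU (3/7) — field currency I: NORM ONE, the HILBERT-90 UNIT, the derivation `σ − 1`

Node «TwistedToricCut» (decomp-res lens-1 g33), tree file 3/7.  `E` a field, `O` a valuation ring of `E`,
`σ : E ≃+* E` preserving `O` both ways.

* valuation bookkeeping for `σ` and for principal units (`v(ab − 1) < 1`, products, powers);
* `norm_eq_one` — NORM ONE: if `σ^p = 1` in characteristic `p` and `σ w = w (1 + η)^n` for some `w ≠ 0`,
  `n ≠ 0`, `v(η) > 0`, then `∏_{i<p} σ^i (1 + η) = 1` (a principal unit which is a root of unity is `1`: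
  tree `WildLogDiagonalLU.one_add_zpow_ne_one`);
* `apply_twistUnit` — the HILBERT-90 UNIT `Φ = ∏_{i<p} (σ^i U)^i` satisfies `σ Φ = Φ U^p` when `N(U) = 1`, `σ^p = 1`;
* `exists_apply_sub_eq_mul_eta` — on the local ring `T_𝔪′` with r.s.p. `x`, `σ xᵢ = xᵢ (1 + η)^{Nᵢ}`:
  `σ b − b ∈ η 𝔪′` (from g32's `WildLogDiagonalLU.exists_apply_sub_eq_sum`).

(Sources: Hilbert Satz 90 for cyclic groups, folklore; KiralyLutkebohmert2013 Ex. 6; tree WildLogDiagonalLU 1–2.)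
-/

noncomputable section

open IsLocalRing Literature.AlgebraicGeometry.Resolution
open Summit.ResolutionOfSingularities.ResolutionOfSingularities.Theorems.InvariantDescentLU
open Summit.ResolutionOfSingularities.ResolutionOfSingularities.Theorems.WildReflectionLU
open Summit.ResolutionOfSingularities.ResolutionOfSingularities.Theorems.WildLogDiagonalLU

universe u

namespace Summit.ResolutionOfSingularities.ResolutionOfSingularities.Theorems.WildTwistedToricLU

variable {E : Type u} [Field E] (O : ValuationSubring E)

section Valuation

variable {σ : E ≃+* E}

/-- An automorphism preserving `O` both ways preserves `𝔪_O` both ways. [folklore] -/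
theorem valuation_apply_lt_one_iff (hσO : ∀ z : E, z ∈ O ↔ σ z ∈ O) (z : E) :
    O.valuation (σ z) < 1 ↔ O.valuation z < 1 := by
  have key : ∀ τ : E ≃+* E, (∀ z : E, z ∈ O ↔ τ z ∈ O) → ∀ z, O.valuation z < 1 → O.valuation (τ z) < 1 := by
    intro τ hτ z hz
    have hzO : τ z ∈ O := (hτ z).mp ((O.valuation_le_one_iff z).mp hz.le)
    rcases ((O.valuation_le_one_iff _).mpr hzO).lt_or_eq with h | h
    · exact h
    · exfalso
      have hτs : ∀ z : E, z ∈ O ↔ τ.symm z ∈ O := fun z => by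
        rw [hτ (τ.symm z), RingEquiv.apply_symm_apply]
      have h1 := valuation_apply_eq_one O hτs h
      rw [RingEquiv.symm_apply_apply] at h1
      exact hz.ne h1
  have hsymm : ∀ z : E, z ∈ O ↔ σ.symm z ∈ O := fun z => by
    rw [hσO (σ.symm z), RingEquiv.apply_symm_apply]
  refine ⟨fun h => ?_, key σ hσO z⟩
  have h1 := key σ.symm hsymm (σ z) h
  rwa [RingEquiv.symm_apply_apply] at h1

/-- … and so do its iterates. [folklore] -/
theorem valuation_pow_apply_lt_one (hσO : ∀ z : E, z ∈ O ↔ σ z ∈ O) (i : ℕ) {z : E}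
    (hz : O.valuation z < 1) : O.valuation ((σ ^ i) z) < 1 := by
  induction i with
  | zero => rwa [pow_zero, RingAut.one_apply]
  | succ i ih => rw [pow_succ', RingAut.mul_apply]; exact (valuation_apply_lt_one_iff O hσO _).mpr ih

/-- Principal units are closed under products: `v(a − 1), v(b − 1) < 1 ⇒ v(ab − 1) < 1`. [folklore] -/
theorem valuation_mul_sub_one_lt {a b : E} (ha : O.valuation (a - 1) < 1) (hb : O.valuation (b - 1) < 1) :
    O.valuation (a * b - 1) < 1 := by
  have hb1 : O.valuation b = 1 := by
    have := valuation_one_add_eq_one O hb; rwa [add_sub_cancel] at this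
  have e : a * b - 1 = (a - 1) * b + (b - 1) := by ring
  rw [e]
  refine Valuation.map_add_lt _ ?_ hb
  rw [map_mul, hb1, mul_one]; exact ha

/-- Powers of principal units are principal units. [folklore] -/
theorem valuation_pow_sub_one_lt {a : E} (ha : O.valuation (a - 1) < 1) (n : ℕ) :
    O.valuation (a ^ n - 1) < 1 := by
  induction n with
  | zero => rw [pow_zero, sub_self, map_zero]; exact zero_lt_one
  | succ n ih => rw [pow_succ]; exact valuation_mul_sub_one_lt O ih ha

/-- Finite products of principal units are principal units. [folklore] -/
theorem valuation_prod_sub_one_lt {ι : Type*} (s : Finset ι) (f : ι → E)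
    (hf : ∀ i ∈ s, O.valuation (f i - 1) < 1) : O.valuation (∏ i ∈ s, f i - 1) < 1 := by
  classical
  induction s using Finset.induction_on with
  | empty => rw [Finset.prod_empty, sub_self, map_zero]; exact zero_lt_one
  | insert i s hi ih =>
    rw [Finset.prod_insert hi]
    exact valuation_mul_sub_one_lt O (hf i (Finset.mem_insert_self i s))
      (ih fun j hj => hf j (Finset.mem_insert_of_mem hj))

end Valuation

section NormOne

variable {σ : E ≃+* E}

/-- **NORM ONE.**  In characteristic `p`, for `σ` of order `p` preserving `O` and a non-zero `w` with
`σ w = w (1 + η)^n`, `n ≠ 0`, `v(η) > 0`: the norm `∏_{i<p} σ^i (1 + η)` is `1`.  (Apply `σ^p = 1` to `w`: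
`N(1 + η)^n = 1`; a principal unit of finite order is `1` — `one_add_zpow_ne_one`.) [folklore; this node] -/
theorem norm_eq_one (p : ℕ) [Fact p.Prime] [CharP E p] (hσO : ∀ z : E, z ∈ O ↔ σ z ∈ O)
    (hσp : σ ^ p = 1) {η : E} (hηv : O.valuation η < 1) {w : E} (hw0 : w ≠ 0) {n : ℤ}
    (hn : n ≠ 0) (hσw : σ w = w * (1 + η) ^ n) :
    ∏ i ∈ Finset.range p, (σ ^ i) (1 + η) = 1 := by
  set Nm : E := ∏ i ∈ Finset.range p, (σ ^ i) (1 + η) with hNm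
  have step : ∀ i : ℕ, (σ ^ i) w = w * ∏ k ∈ Finset.range i, ((σ ^ k) (1 + η)) ^ n := by
    intro i
    induction i with
    | zero => rw [pow_zero, RingAut.one_apply, Finset.prod_range_zero, mul_one]
    | succ i ih =>
      rw [pow_succ, RingAut.mul_apply, hσw, map_mul, map_zpow₀, ih, Finset.prod_range_succ, mul_assoc]
  have hNmn : Nm ^ n = 1 := by
    have h := step p
    rw [hσp, RingAut.one_apply, Finset.prod_zpow] at h
    have h2 : w * Nm ^ n = w * 1 := by rw [mul_one]; exact h.symm
    exact mul_left_cancel₀ hw0 h2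
  -- `Nm` is a principal unit
  have hθv : O.valuation (Nm - 1) < 1 := by
    refine valuation_prod_sub_one_lt O _ _ fun i _ => ?_
    rw [map_add, map_one, add_sub_cancel_left]
    exact valuation_pow_apply_lt_one O hσO i hηv
  have hθO : Nm - 1 ∈ O := (O.valuation_le_one_iff _).mp hθv.le
  by_contra hNm1
  have hθ0 : Nm - 1 ≠ 0 := sub_ne_zero.mpr hNm1
  have h := one_add_zpow_ne_one O p hθO hθv hθ0 hn
  rw [add_sub_cancel] at h
  exact h hNmn

/-- **THE HILBERT-90 UNIT.**  For `σ^p = 1` and `U ≠ 0` of norm `∏_{i<p} σ^i U = 1`, the element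
`Φ = ∏_{i<p} (σ^i U)^i` satisfies `σ Φ = Φ · U^p` (Hilbert's Satz 90 for the cocycle `U` made explicit:
`U = Φ^{1/p}`-twist).  Nearest print: Peskin splits the same norm-one unit cocycle through `H¹(G, S^*) = 0`
for a FACTORIAL invariant ring (Thm. 3.8 and the Proposition after Conj. 3.10, p. 82); here the coboundary is
explicit and needs only `σ^p = 1` and norm one — no factoriality (the invariant ring of `λ′` is not factorial in
general). [folklore (Hilbert Satz 90, cyclic case); cite: Peskin1983, Thm. 3.8] -/
theorem apply_twistUnit {p : ℕ} (hσp : σ ^ p = 1) {U : E} (hU0 : U ≠ 0)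
    (hnorm : ∏ i ∈ Finset.range p, (σ ^ i) U = 1) :
    σ (∏ i ∈ Finset.range p, ((σ ^ i) U) ^ i) = (∏ i ∈ Finset.range p, ((σ ^ i) U) ^ i) * U ^ p := by
  have hshift : ∀ i : ℕ, σ ((σ ^ i) U) = (σ ^ (i + 1)) U := fun i => by
    rw [pow_succ', RingAut.mul_apply]
  have h1 : σ (∏ i ∈ Finset.range p, ((σ ^ i) U) ^ i) = ∏ i ∈ Finset.range p, ((σ ^ (i + 1)) U) ^ i := by
    rw [map_prod]
    exact Finset.prod_congr rfl fun i _ => by rw [map_pow, hshift]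
  -- the shifted norm is again `1`
  have h2 : ∏ i ∈ Finset.range p, (σ ^ (i + 1)) U = 1 := by
    have e := Finset.prod_range_succ' (fun i => (σ ^ i) U) p
    rw [Finset.prod_range_succ, hnorm, one_mul, hσp, RingAut.one_apply, pow_zero, RingAut.one_apply] at e
    exact mul_right_cancel₀ hU0 (by rw [one_mul]; exact e.symm)
  -- the shifted `Φ` times the shifted norm is `Φ · U^p`
  have h3 : (∏ i ∈ Finset.range p, ((σ ^ (i + 1)) U) ^ i) * ∏ i ∈ Finset.range p, (σ ^ (i + 1)) U =
      (∏ i ∈ Finset.range p, ((σ ^ i) U) ^ i) * U ^ p := by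
    rw [← Finset.prod_mul_distrib]
    have e := Finset.prod_range_succ' (fun i => ((σ ^ i) U) ^ i) p
    rw [pow_zero, mul_one, Finset.prod_range_succ, hσp, RingAut.one_apply] at e
    rw [e]
    exact Finset.prod_congr rfl fun i _ => (pow_succ ((σ ^ (i + 1)) U) i).symm
  rw [h1, ← h3, h2, mul_one]

end NormOne

section Derivation

variable {T : Subring E} {σ : E ≃+* E}

/-- `(1 + η)^N − 1 ∈ η · B` for every `N ∈ ℤ` (`B` a subring containing `η` and `(1 + η)⁻¹`). [folklore] -/
theorem exists_one_add_zpow_sub_one_eq_mul (B : Subring E) {η : E} (hη : η ∈ B) (h0 : 1 + η ≠ 0)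
    (hinv : (1 + η)⁻¹ ∈ B) (N : ℤ) : ∃ e ∈ B, (1 + η) ^ N - 1 = η * e := by
  obtain ⟨n, rfl | rfl⟩ := N.eq_nat_or_neg
  · exact ⟨_, geom_sum_mem B hη n, by rw [zpow_natCast]; exact one_add_pow_sub_one η n⟩
  · refine ⟨-(((1 + η)⁻¹) ^ n * ∑ i ∈ Finset.range n, (1 + η) ^ i),
      B.neg_mem (B.mul_mem (B.pow_mem hinv n) (geom_sum_mem B hη n)), ?_⟩
    have h := one_add_pow_sub_one η n
    rw [zpow_neg, zpow_natCast, ← inv_pow]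
    have hinv1 : (1 + η)⁻¹ ^ n * (1 + η) ^ n = 1 := by rw [← mul_pow, inv_mul_cancel₀ h0, one_pow]
    linear_combination (-((1 + η)⁻¹ ^ n)) * h + hinv1

/-- **The derivation `σ − 1` takes values in `η𝔪′`.**  On the local ring `T_𝔪′` (Noetherian, residues represented
by `σ`-invariants, r.s.p. `x`) with `σ xᵢ = xᵢ (1 + η)^{Nᵢ}`, `η, (1 + η)⁻¹ ∈ T_𝔪′`: for every `b ∈ T_𝔪′`,
`σ b − b = η m` with `m ∈ 𝔪′`. (g32's `exists_apply_sub_eq_sum`: `σ b − b ∈ (σxᵢ − xᵢ)ᵢ`, and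
`σ xᵢ − xᵢ = xᵢ η eᵢ`.) [cite: KiralyLutkebohmert2013, Rem. 3; tree WildLogDiagonalLU2] -/
theorem exists_apply_sub_eq_eta_mul (hTO : T ≤ O.toSubring) (hσO : ∀ z : E, z ∈ O ↔ σ z ∈ O)
    (hσT : ∀ z ∈ T, σ z ∈ T) [IsNoetherianRing (locAtCentre T O)]
    (hres : ∀ b ∈ locAtCentre T O, ∃ c ∈ locAtCentre T O, σ c = c ∧ O.valuation (b - c) < 1)
    {d : ℕ} {x : Fin d → E} (hx : ∀ i, x i ∈ locAtCentre T O ∧ O.valuation (x i) < 1)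
    (hgen : ∀ b ∈ locAtCentre T O, O.valuation b < 1 →
      ∃ c : Fin d → E, (∀ i, c i ∈ locAtCentre T O) ∧ b = ∑ i, c i * x i)
    {η : E} (hη : η ∈ locAtCentre T O) (h0 : 1 + η ≠ 0) (hinv : (1 + η)⁻¹ ∈ locAtCentre T O)
    (N : Fin d → ℤ) (hσx : ∀ i, σ (x i) = x i * (1 + η) ^ N i) {b : E} (hb : b ∈ locAtCentre T O) :
    ∃ m ∈ locAtCentre T O, O.valuation m < 1 ∧ σ b - b = η * m := by
  classical
  set B : Subring E := locAtCentre T O with hB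
  have hBO : B ≤ O.toSubring := locAtCentre_le hTO
  obtain ⟨c, hc, hsum⟩ := exists_apply_sub_eq_sum O hTO hσO hσT hres hx hgen hb
  choose e he hee using fun i => exists_one_add_zpow_sub_one_eq_mul B hη h0 hinv (N i)
  refine ⟨∑ i, c i * (x i * e i), B.sum_mem fun i _ => B.mul_mem (hc i) (B.mul_mem (hx i).1 (he i)), ?_, ?_⟩
  · refine Valuation.map_sum_lt _ one_ne_zero fun i _ => ?_
    rw [map_mul, map_mul]
    have h1 : O.valuation (c i) ≤ 1 := (O.valuation_le_one_iff _).mpr (hBO (hc i))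
    have h2 : O.valuation (e i) ≤ 1 := (O.valuation_le_one_iff _).mpr (hBO (he i))
    calc O.valuation (c i) * (O.valuation (x i) * O.valuation (e i))
        ≤ 1 * (O.valuation (x i) * 1) := mul_le_mul' h1 (mul_le_mul' le_rfl h2)
      _ < 1 := by rw [one_mul, mul_one]; exact (hx i).2
  · rw [hsum, Finset.mul_sum]
    exact Finset.sum_congr rfl fun i _ => by
      rw [hσx, ← mul_sub_one, hee]; ring

end Derivation

end Summit.ResolutionOfSingularities.ResolutionOfSingularities.Theorems.WildTwistedToricLU

end
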